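import Mathlib
import Summits.Ventures.PercRepro2.LocRows
import Summits.Ventures.PercRepro2.SwRow
import Summits.Ventures.PercRepro2.SwOut
import Summits.Ventures.PercRepro2.SwAllRow
import Summits.Ventures.PercRepro2.SwOutAll
import Summits.Ventures.PercRepro2.SwOutArmFlip
import Summits.Ventures.PercRepro2.SwOutArmThm
import Summits.Ventures.PercRepro2.SwOutCoreDefs
import Summits.Ventures.PercRepro2.SwOutBigBlockDefs
import Summits.Ventures.PercRepro2.SwOutMixedBaseDefs
import Summits.Ventures.PercRepro2.SwOutMixedBaseClasses
import Summits.Ventures.PercRepro2.SwOutMixedBaseHull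
import Summits.Ventures.PercRepro2.SwOutMixedBaseDual
import Summits.Ventures.PercRepro2.SwOutMixedCore
import Summits.Ventures.PercRepro2.SwOutMixedCoreEdgeMap

/-!
# The edge-set form of the hull formulas of the mixed single junction (blind cell PercRepro2,
night-4 g18, 2026-08-27; proofs/NIGHT4-G18.md §4, item (G2′) of NIGHT4-G17.md §4⁗′)

Vocabulary: the mixed base `MixedBase` with its realisation `mixedReal` (`SwOutMixedBaseDefs`),
the red hull formula `cluster_mixedReal` at a point without red-side leak (`SwOutMixedBaseHull`),
the dual base and the blue hull formula (`SwOutMixedBaseDual`), the corrected leak set `Leak'` of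
the abstract block (`SwOutMixedCore`), the red / blue edge sets `redEdges` / `blueEdges` of `h`
(`SwOutAll`), the edge map `φM` and the red classes `redClassM` with the membership lemmas of
`redSetM` (`SwOutMixedCoreEdgeMap`).

This file: the EDGE-SET FORMS of the hull formulas — at a point without red-side leak, the
red edges of the red cluster of `h` are exactly the red classes of the abstract red set
(`redEdges_mixedReal`), and at a point without blue-side leak the blue edges of the blue cluster
are the red classes of the abstract blue set (`blueEdges_mixedReal`, by duality: the dual base has
the same red classes, `redClassM_dualMixed`).  These are the hypotheses `hR` / `hB` of the
transfer `card_le_of_mixedCore_edges` (`SwOutMixedCoreTransfer`).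
-/

namespace Summit.Ventures.PercRepro2

namespace BigBlock

open Hull LocRows

variable {V : Type*} {E : Type*}

section RedEdges

variable {ends : E → Sym2 V} {σ : Config E} {h u p : V} {ι κ : Type*} {U : ι → Set V} {Ah : Set V}
  {F : κ → Set V} (hb : MixedBase ends σ h u p U Ah F)
include hb

/-- An edge inside `U j ∪ {h, u}` touches `U j`. -/
lemma MixedBase.touches_U_of_within' {j : ι} {e : E} (he : e ∈ within ends (U j ∪ {h, u})) :
    e ∈ touches ends (U j) := by
  obtain ⟨x, hx, y, hy, hxy⟩ := he
  rcases hx with hx | hx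
  · exact ⟨x, hx, y, hxy⟩
  rcases hy with hy | hy
  · exact ⟨y, hy, x, ends_swap hxy⟩
  exfalso
  simp only [Set.mem_insert_iff, Set.mem_singleton_iff] at hx hy
  rcases hx with rfl | rfl <;> rcases hy with rfl | rfl
  · exact hb.loop_h e hxy
  · exact hb.no_hu e hxy
  · exact hb.no_hu e (ends_swap hxy)
  · exact hb.loop_u e hxy

/-- A vertex of `U j ∪ {h, u}` is in the predicted red cluster when `U j` is red. -/
lemma MixedBase.mem_redSetM_of_mem_U_h_u {q : Pt ι κ} {j : ι} (hj : q.1 j = true) {x : V}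
    (hx : x ∈ U j ∪ {h, u}) : x ∈ redSetM h u p U Ah F q := by
  rcases hx with hx | hx
  · exact (hb.mem_redSetM_U hx).2 hj
  · simp only [Set.mem_insert_iff, Set.mem_singleton_iff] at hx
    rcases hx with rfl | rfl
    · rw [mem_redSetM_iff]; exact Or.inl rfl
    · exact hb.mem_redSetM_u.2 ⟨j, hj⟩

/-- A vertex of `Ah ∪ {h}` is in the predicted red cluster when the h-piece is red. -/
lemma MixedBase.mem_redSetM_of_mem_Ah_h {q : Pt ι κ} (ha : q.2.1 = true) {x : V}
    (hx : x ∈ Ah ∪ {h}) : x ∈ redSetM h u p U Ah F q := by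
  rcases hx with hx | hx
  · exact (hb.mem_redSetM_Ah hx).2 ha
  · rw [Set.mem_singleton_iff] at hx
    rw [hx, mem_redSetM_iff]
    exact Or.inl rfl

/-- A vertex of `F k ∪ {h}` is in the predicted red cluster when `F k` is red. -/
lemma MixedBase.mem_redSetM_of_mem_F_h {q : Pt ι κ} {k : κ} (hk : q.2.2.2.2 k = true) {x : V}
    (hx : x ∈ F k ∪ {h}) : x ∈ redSetM h u p U Ah F q := by
  rcases hx with hx | hx
  · exact (hb.mem_redSetM_F hx).2 hk
  · rw [Set.mem_singleton_iff] at hx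
    rw [hx, mem_redSetM_iff]
    exact Or.inl rfl

/-- **The red edge-set form of the hull formula**: at a point without red-side leak, the red edges
of the red cluster of `h` are exactly the red classes of the abstract red set (assuming an edge
between `u` and `p`). -/
theorem MixedBase.redEdges_mixedReal (hup : ∃ e, ends e = s(u, p)) {q : Pt ι κ} (hq : ¬ LeakR q) :
    redEdges ends (mixedReal ends u p U Ah F σ q) h = φM ends σ h u p U Ah F (ER q) := by
  ext e
  rw [mem_redEdges, hb.cluster_mixedReal hup hq, mem_φM]
  constructor
  · rintro ⟨hred, x, hx, y, hy, hxy⟩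
    rw [mem_redSetM_iff] at hx
    rcases hx with rfl | ⟨j, hj, hx⟩ | ⟨rfl, hs⟩ | ⟨rfl, hs, huP⟩ | ⟨ha, hx⟩ | ⟨k, hk, hx⟩
    · -- `x = h`: the edge goes into an arm
      rcases hb.h_edges e y hxy with ⟨j, hy'⟩ | hy' | ⟨k, hy'⟩
      · have hj : q.1 j = true := (hb.mem_redSetM_U hy').1 hy
        refine ⟨Sum.inl j, Or.inl (Or.inl (Or.inl (Or.inl ⟨j, hj, rfl⟩))), ?_⟩
        rw [redClassM_inl]
        refine ⟨?_, x, Or.inr (Or.inl rfl), y, Or.inl hy', hxy⟩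
        rwa [hb.mixedReal_apply_U ⟨y, hy', x, ends_swap hxy⟩, if_pos hj] at hred
      · have ha : q.2.1 = true := (hb.mem_redSetM_Ah hy').1 hy
        refine ⟨aA, Or.inl (Or.inl (Or.inr ⟨rfl, ha⟩)), ?_⟩
        rw [redClassM_aA]
        refine ⟨?_, x, Or.inr rfl, y, Or.inl hy', hxy⟩
        rwa [hb.mixedReal_apply_Ah ⟨y, hy', x, ends_swap hxy⟩, if_pos ha] at hred
      · have hk : q.2.2.2.2 k = true := (hb.mem_redSetM_F hy').1 hy
        refine ⟨Sum.inr (Sum.inr k), Or.inr ⟨k, hk, rfl⟩, ?_⟩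
        rw [redClassM_inr]
        refine ⟨?_, x, Or.inr rfl, y, Or.inl hy', hxy⟩
        rwa [hb.mixedReal_apply_F ⟨y, hy', x, ends_swap hxy⟩, if_pos hk] at hred
    · -- `x ∈ U j`, red
      have hσ : σ e = true := by
        rwa [hb.mixedReal_apply_U ⟨x, hx, y, hxy⟩, if_pos hj] at hred
      refine ⟨Sum.inl j, Or.inl (Or.inl (Or.inl (Or.inl ⟨j, hj, rfl⟩))), ?_⟩
      rw [redClassM_inl]
      refine ⟨hσ, x, Or.inl hx, y, ?_, hxy⟩
      rw [mem_redSetM_iff] at hy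
      rcases hy with rfl | ⟨j', _, hy⟩ | ⟨rfl, _⟩ | ⟨rfl, _⟩ | ⟨_, hy⟩ | ⟨k, _, hy⟩
      · exact Or.inr (Or.inl rfl)
      · by_cases hjj : j = j'
        · subst hjj; exact Or.inl hy
        · exact absurd hy (fun hy => hb.no_cross_UU j j' hjj e x y hxy hx hy)
      · exact Or.inr (Or.inr rfl)
      · exact absurd hx (hb.no_pU (ends_swap hxy) j)
      · exact absurd hy (fun hy => hb.no_cross_UAh j e x y hxy hx hy)
      · exact absurd hy (fun hy => hb.no_cross_UF j k e x y hxy hx hy)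
    · -- `x = u`: the edge goes into a u-arm or to `p`
      rcases hb.u_edges e y hxy with ⟨j, hy'⟩ | rfl
      · have hj : q.1 j = true := (hb.mem_redSetM_U hy').1 hy
        refine ⟨Sum.inl j, Or.inl (Or.inl (Or.inl (Or.inl ⟨j, hj, rfl⟩))), ?_⟩
        rw [redClassM_inl]
        refine ⟨?_, x, Or.inr (Or.inr rfl), y, Or.inl hy', hxy⟩
        rwa [hb.mixedReal_apply_U ⟨y, hy', x, ends_swap hxy⟩, if_pos hj] at hred
      · have huP : q.2.2.1 = true := (hb.mem_redSetM_p.1 hy).2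
        refine ⟨pA, Or.inl (Or.inr ⟨rfl, hs, huP⟩), ?_⟩
        rw [redClassM_pA]
        exact hxy
    · -- `x = p`: the edge goes to `u`, into the h-piece (dead) or outside
      by_cases hyu : y = u
      · subst hyu
        refine ⟨pA, Or.inl (Or.inr ⟨rfl, hs, huP⟩), ?_⟩
        rw [redClassM_pA]
        exact ends_swap hxy
      rcases hb.p_edges e y hxy with hyu' | hy' | ⟨hyh, hyp, hyA⟩
      · exact absurd hyu' hyu
      · -- a dead edge, blue at the base: red only if the h-piece is flipped, a leak
        exfalso
        by_cases ha : q.2.1 = true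
        · rw [hb.mixedReal_apply_Ah ⟨y, hy', x, ends_swap hxy⟩, if_pos ha, hb.dead_blue e y hxy hy']
            at hred
          exact absurd hred (by decide)
        · exact hq ⟨hs, huP, Or.inr (by simpa using ha)⟩
      · exact absurd hy (not_mem_redSetM_of_out hyh hyu hyp hyA)
    · -- `x ∈ Ah`, red
      have hσ : σ e = true := by
        rwa [hb.mixedReal_apply_Ah ⟨x, hx, y, hxy⟩, if_pos ha] at hred
      refine ⟨aA, Or.inl (Or.inl (Or.inr ⟨rfl, ha⟩)), ?_⟩
      rw [redClassM_aA]
      refine ⟨hσ, x, Or.inl hx, y, ?_, hxy⟩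
      rw [mem_redSetM_iff] at hy
      rcases hy with rfl | ⟨j, _, hy⟩ | ⟨rfl, _⟩ | ⟨rfl, _⟩ | ⟨_, hy⟩ | ⟨k, _, hy⟩
      · exact Or.inr rfl
      · exact absurd hx (fun hx => hb.no_cross_UAh j e y x (ends_swap hxy) hy hx)
      · exact absurd hx (hb.no_uAh (ends_swap hxy))
      · exfalso
        rw [hb.dead_blue e x (ends_swap hxy) hx] at hσ
        exact absurd hσ (by decide)
      · exact Or.inl hy
      · exact absurd hy (fun hy => hb.no_cross_AhF k e x y hxy hx hy)
    · -- `x ∈ F k`, red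
      have hσ : σ e = true := by
        rwa [hb.mixedReal_apply_F ⟨x, hx, y, hxy⟩, if_pos hk] at hred
      refine ⟨Sum.inr (Sum.inr k), Or.inr ⟨k, hk, rfl⟩, ?_⟩
      rw [redClassM_inr]
      refine ⟨hσ, x, Or.inl hx, y, ?_, hxy⟩
      rw [mem_redSetM_iff] at hy
      rcases hy with rfl | ⟨j, _, hy⟩ | ⟨rfl, _⟩ | ⟨rfl, _⟩ | ⟨_, hy⟩ | ⟨k', _, hy⟩
      · exact Or.inr rfl
      · exact absurd hx (fun hx => hb.no_cross_UF j k e y x (ends_swap hxy) hy hx)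
      · exact absurd hx (hb.no_uF (ends_swap hxy) k)
      · exact absurd hx (hb.no_pF (ends_swap hxy) k)
      · exact absurd hx (fun hx => hb.no_cross_AhF k e y x (ends_swap hxy) hy hx)
      · by_cases hkk : k = k'
        · subst hkk; exact Or.inl hy
        · exact absurd hy (fun hy => hb.no_cross_FF k k' hkk e x y hxy hx hy)
  · rintro ⟨α, hα, he⟩
    rcases hα with ((((⟨j, hj, rfl⟩ | ⟨rfl, hs⟩) | ⟨rfl, ha⟩) | ⟨rfl, hs, huP⟩) | ⟨k, hk, rfl⟩)
    · -- a red u-arm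
      have hj' : q.1 j = true := hj
      rw [redClassM_inl] at he
      obtain ⟨hσ, hw⟩ := he
      refine ⟨?_, ?_⟩
      · rw [hb.mixedReal_apply_U (hb.touches_U_of_within' hw), if_pos hj']
        exact hσ
      · obtain ⟨x, hx, y, hy, hxy⟩ := hw
        exact ⟨x, hb.mem_redSetM_of_mem_U_h_u hj' hx, y, hb.mem_redSetM_of_mem_U_h_u hj' hy, hxy⟩
    · -- `u`: no edges of its own
      rw [redClassM_uA] at he
      exact ((Set.mem_empty_iff_false e).1 he).elim
    · -- the red h-piece
      rw [redClassM_aA] at he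
      obtain ⟨hσ, hw⟩ := he
      refine ⟨?_, ?_⟩
      · rw [hb.mixedReal_apply_Ah (hb.touches_Ah_of_within hw), if_pos ha]
        exact hσ
      · obtain ⟨x, hx, y, hy, hxy⟩ := hw
        exact ⟨x, hb.mem_redSetM_of_mem_Ah_h ha hx, y, hb.mem_redSetM_of_mem_Ah_h ha hy, hxy⟩
    · -- the u–p edges, red
      rw [redClassM_pA] at he
      have hup' : ends e = s(u, p) := he
      refine ⟨?_, u, hb.mem_redSetM_u.2 hs, p, hb.mem_redSetM_p.2 ⟨hs, huP⟩, hup'⟩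
      rw [hb.mixedReal_apply_UP he, if_pos huP]
      exact hb.u_red e p hup'
    · -- a red far arm
      have hk' : q.2.2.2.2 k = true := hk
      rw [redClassM_inr] at he
      obtain ⟨hσ, hw⟩ := he
      refine ⟨?_, ?_⟩
      · rw [hb.mixedReal_apply_F (hb.touches_F_of_within hw), if_pos hk']
        exact hσ
      · obtain ⟨x, hx, y, hy, hxy⟩ := hw
        exact ⟨x, hb.mem_redSetM_of_mem_F_h hk' hx, y, hb.mem_redSetM_of_mem_F_h hk' hy, hxy⟩

end RedEdges

section BlueEdges

variable {ends : E → Sym2 V} {σ : Config E} {h u p : V} {ι κ : Type*} {U : ι → Set V} {Ah : Set V}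
  {F : κ → Set V} (hb : MixedBase ends σ h u p U Ah F)
include hb

/-- The dual base has the same red classes (their edges are class edges, where the dual base agrees
with the base). -/
lemma MixedBase.redClassM_dualMixed (α : Atom ι κ) :
    redClassM ends (dualMixed ends u p U Ah F σ) h u p U Ah F α =
      redClassM ends σ h u p U Ah F α := by
  rcases α with j | (i | k)
  · ext e
    simp only [redClassM_inl, Set.mem_setOf_eq]
    constructor
    · rintro ⟨hσ, hw⟩
      refine ⟨?_, hw⟩
      rwa [dualMixed_apply_of_mem (Or.inl (Or.inl (Or.inl (Or.inl ⟨j, hb.touches_U_of_within' hw⟩))))]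
        at hσ
    · rintro ⟨hσ, hw⟩
      refine ⟨?_, hw⟩
      rwa [dualMixed_apply_of_mem (Or.inl (Or.inl (Or.inl (Or.inl ⟨j, hb.touches_U_of_within' hw⟩))))]
  · fin_cases i
    · simp [redClassM]
    · ext e
      simp only [redClassM, Set.mem_setOf_eq, Fin.isValue, Fin.mk_one, if_true, if_false,
        Fin.reduceEq]
      constructor
      · rintro ⟨hσ, hw⟩
        refine ⟨?_, hw⟩
        rwa [dualMixed_apply_of_mem (Or.inl (Or.inl (Or.inl (Or.inr (hb.touches_Ah_of_within hw)))))]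
          at hσ
      · rintro ⟨hσ, hw⟩
        refine ⟨?_, hw⟩
        rwa [dualMixed_apply_of_mem (Or.inl (Or.inl (Or.inl (Or.inr (hb.touches_Ah_of_within hw)))))]
    · simp [redClassM]
  · ext e
    simp only [redClassM_inr, Set.mem_setOf_eq]
    constructor
    · rintro ⟨hσ, hw⟩
      refine ⟨?_, hw⟩
      rwa [dualMixed_apply_of_mem (Or.inr ⟨k, hb.touches_F_of_within hw⟩)] at hσ
    · rintro ⟨hσ, hw⟩
      refine ⟨?_, hw⟩
      rwa [dualMixed_apply_of_mem (Or.inr ⟨k, hb.touches_F_of_within hw⟩)]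

/-- The edge map of the dual base is the edge map of the base. -/
lemma MixedBase.φM_dualMixed (S : Set (Atom ι κ)) :
    φM ends (dualMixed ends u p U Ah F σ) h u p U Ah F S = φM ends σ h u p U Ah F S := by
  simp only [φM, hb.redClassM_dualMixed]

/-- **The blue edge-set form of the hull formula**: at a point without blue-side leak, the blue
edges of the blue cluster of `h` are exactly the red classes of the abstract blue set (duality). -/
theorem MixedBase.blueEdges_mixedReal (hup : ∃ e, ends e = s(u, p)) {q : Pt ι κ} (hq : ¬ LeakB q) :
    blueEdges ends (mixedReal ends u p U Ah F σ q) h = φM ends σ h u p U Ah F (EB q) := by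
  rw [blueEdges, hb.blue_mixedReal, hb.dual.redEdges_mixedReal hup hq, hb.φM_dualMixed]
  rfl

end BlueEdges

end BigBlock

end Summit.Ventures.PercRepro2
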